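import Summits.Ventures.LatticeQCDFlow.TrivializingMaps.FlowAutocorrelationFloorAnyGroup
import Summits.Ventures.LatticeQCDFlow.Scaling.FlowReachLaw

/-!
HONEST FRAMING: exact (Metropolis-corrected) sampling algorithms for lattice gauge theory; figures
of merit are autocorrelation/cost numbers at stated couplings and volumes; no continuum-physics
claim.

# FlowAutocorrelationReach — THE AUTOCORRELATION FLOOR OF AN EXACT FLOW SAMPLER ANCHORED AT COUPLING `a`
# AND RUN AT COUPLING `b`, AND THE `SU(n)` FORM WITH POLYNOMIAL CONSTANTS: `ρ_g(n) ≥ (1 − B²·C·Gaussian/E_b[g²])ⁿ`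
# (lean-2 GEN-12, ours)

Venture-side (OURS).  Cell `lqcd-flow` (pub-lqcd), unit `pub-lqcd-lean-2-g12`, 2026-08-23.  Two dockings of
`TrivializingMaps/FlowAutocorrelationFloorAnyGroup.wilson_flow_autocorr_ge_pow` (every bounded observable of
the exact flow sampler of `μ_b` has `ρ_g(n+1) ≥ (max 0 (1 − B²·acc/E_b[g²]))^{n+1}`):

* **`wilson_flow_autocorr_ge_pow_reach`** — GEN-11's REACH LAW (`Scaling/FlowReachLaw.wilson_flowReach_le_allCouplings`:
  a model density `0 < q ≤ C·p_a` anchored at the Wilson density of coupling `a` is accepted at coupling `b`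
  with `acc ≤ C·exp(−e^{−Bc}⌊L/2⌋^d v_ρ (b−a)²/4)`, `−B ≤ a ≤ b ≤ B`, unitary `ρ`, `d ≥ 2`, `L ≥ 2`) ⇒
  `ρ_g(n+1) ≥ (max 0 (1 − B_g²·C·exp(−e^{−B·2NK(1+4K)}⌊L/2⌋^d·Var_Haar(Re tr ρ)·(b−a)²/4)/E_b[g²]))^{n+1}`:
  a sampler trained at (or anchored to) coupling `a` decorrelates at coupling `b` only if
  `(b − a) = O(√(log C/volume))`;
* **`wilson_flow_autocorr_ge_pow_sun`** — `SU(n)`, `n ≥ 2`, `d ≥ 2`, model density `0 < q ≤ C` over `D[U]`: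
  one `c = c(n,d) > 0` with `ρ_g(m+1) ≥ (max 0 (1 − B_g²·C·exp(−c·#plaq·β²/(4(1+β²)))/E_β[g²]))^{m+1}` for
  every `L ≥ 2`, `β ≥ 0` (GEN-11's `wilson_flowAcc_le_sun`, item 129's polynomial floor).

Reading (no numerics implied): POLYNOMIAL-in-`β`, EXTENSIVE-in-volume exponents — at fixed `β > 0` every
bounded observable of the exact `SU(n)` flow sampler with a `C`-bounded model density keeps autocorrelation
`≥ (1 − B²C e^{−c#plaq β²/(4(1+β²))}/E_β[g²])ⁿ`.  NOT CLAIMED: architecture / training statements; `τ_int`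
summability; unbounded observables; the continuum.  Literature grade: KNOWN MECHANISM, NEW TYPING.
-/

noncomputable section

open MeasureTheory ProbabilityTheory Real Set Filter
open Literature.MathematicalPhysics.QuantumFieldTheory
open Literature.MathematicalPhysics.QuantumFieldTheory.Luscher2010
open Summit.Ventures.LatticeQCDFlow.Exactness
open Summit.Ventures.LatticeQCDFlow.Scaling

namespace Summit.Ventures.LatticeQCDFlow.TrivializingMaps

section Reach

variable {d L N : ℕ} [NeZero L] {G : Type*} [Group G] [TopologicalSpace G] [IsTopologicalGroup G]
  [CompactSpace G] [MeasurableSpace G] [BorelSpace G] [SecondCountableTopology G]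
  (ρ : G →* Matrix (Fin N) (Fin N) ℂ)

/-- **AUTOCORRELATION FLOOR WITH REACH** (unitary `ρ`, `d ≥ 2`, `L ≥ 2`, `−B ≤ a ≤ b ≤ B`, model density
`0 < q ≤ C·p_a` over `D[U]` with `∫ q dD[U] = 1`): for every bounded measurable `g` (`|g| ≤ B_g`) with
`E_{μ_b}[g²] > 0` and every `n`, the exact flow sampler of `μ_b` has
`(max 0 (1 − B_g²·C·exp(−e^{−B·2NK(1+4K)}⌊L/2⌋^d·Var_Haar(Re tr ρ)·(b−a)²/4)/E_{μ_b}[g²]))^{n+1} ≤ ρ_g(n+1)`.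
[ours] -/
theorem wilson_flow_autocorr_ge_pow_reach (hd : 2 ≤ d) (hL : 2 ≤ L) (hρ : Continuous ρ)
    (hρu : ∀ g, ρ g ∈ Matrix.unitaryGroup (Fin N) ℂ) {a b B : ℝ} (ha : -B ≤ a) (hab : a ≤ b) (hb : b ≤ B)
    {q : GaugeConfig d L G → ℝ} (hqm : Measurable q) (hq0 : ∀ U, 0 < q U) {C : ℝ}
    (hqC : ∀ U, q U ≤ C * (exp (a * (-wilsonAction ρ U)) /
      mgf (fun U => -wilsonAction ρ U) (trivialMeasure G d L) a))
    (hq1 : ∫ U, q U ∂(trivialMeasure G d L) = 1)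
    {g : GaugeConfig d L G → ℝ} (hgm : Measurable g) {Bg : ℝ} (hgb : ∀ U, |g U| ≤ Bg)
    (hpos : 0 < ∫ U, g U ^ 2 ∂(wilsonMeasure (d := d) (L := L) ρ b)) (n : ℕ) :
    (max 0 (1 - Bg ^ 2 * (C * exp (-(Real.exp (-(B * (2 * N * ((d + 1) * d ^ 2 : ℕ) *
        (1 + 4 * ((d + 1) * d ^ 2 : ℕ))))) * ((L / 2) ^ d : ℕ) *
        variance (fun g => (ρ g).trace.re) (haarProbability G) * (b - a) ^ 2 / 4))) /
        ∫ U, g U ^ 2 ∂(wilsonMeasure (d := d) (L := L) ρ b))) ^ (n + 1) ≤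
      (∫ U, g U * ((imhOp (trivialMeasure G d L)
          (fun U => exp (b * (-wilsonAction ρ U)) / mgf (fun U => -wilsonAction ρ U) (trivialMeasure G d L) b)
          q)^[n + 1] g) U ∂(wilsonMeasure (d := d) (L := L) ρ b)) /
        ∫ U, g U ^ 2 ∂(wilsonMeasure (d := d) (L := L) ρ b) := by
  have hacc := wilson_flowReach_le_allCouplings (d := d) (L := L) ρ hd hL hρ hρu ha hab hb hqm
    (fun U => (hq0 U).le) hqC
  refine le_trans ?_ (wilson_flow_autocorr_ge_pow ρ hρ b hqm hq0 hq1 hgm hgb hpos n)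
  refine pow_le_pow_left₀ (le_max_left _ _) (max_le_max le_rfl ?_) (n + 1)
  exact sub_le_sub_left (div_le_div_of_nonneg_right (mul_le_mul_of_nonneg_left hacc (sq_nonneg Bg))
    hpos.le) 1

end Reach

/-! ## `SU(n)`: polynomial constants -/

section SUN

variable {d n : ℕ}

/-- **`SU(n)` AUTOCORRELATION FLOOR WITH POLYNOMIAL CONSTANTS** (`n ≥ 2`, `d ≥ 2`): there is
`c = c(n,d) > 0` such that for every `L ≥ 2`, every `β ≥ 0`, every measurable model density `0 < q ≤ C`
over `D[U]` with `∫ q dD[U] = 1`, every bounded measurable observable `g` (`|g| ≤ B`) with `E_{μ_β}[g²] > 0`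
and every `m`:
`(max 0 (1 − B²·C·exp(−c·#plaq·β²/(4(1+β²)))/E_{μ_β}[g²]))^{m+1} ≤ ρ_g(m+1)`. [ours] -/
theorem wilson_flow_autocorr_ge_pow_sun (hn : 2 ≤ n) (hd : 2 ≤ d) :
    ∃ c : ℝ, 0 < c ∧ ∀ (L : ℕ) [NeZero L], 2 ≤ L → ∀ β : ℝ, 0 ≤ β →
      ∀ (q : GaugeConfig d L (Matrix.specialUnitaryGroup (Fin n) ℂ) → ℝ), Measurable q →
        (∀ U, 0 < q U) → ∀ C : ℝ, (∀ U, q U ≤ C) →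
        ∫ U, q U ∂(trivialMeasure (Matrix.specialUnitaryGroup (Fin n) ℂ) d L) = 1 →
        ∀ (g : GaugeConfig d L (Matrix.specialUnitaryGroup (Fin n) ℂ) → ℝ), Measurable g →
          ∀ B : ℝ, (∀ U, |g U| ≤ B) →
          0 < ∫ U, g U ^ 2 ∂(wilsonMeasure (d := d) (L := L) (StrongCoupling.defRep n) β) →
          ∀ m : ℕ,
            (max 0 (1 - B ^ 2 * (C * exp (-(c * Fintype.card (Plaquette d L) * β ^ 2 / (4 * (1 + β ^ 2))))) /
                ∫ U, g U ^ 2 ∂(wilsonMeasure (d := d) (L := L) (StrongCoupling.defRep n) β))) ^ (m + 1) ≤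
              (∫ U, g U * ((imhOp (trivialMeasure (Matrix.specialUnitaryGroup (Fin n) ℂ) d L)
                  (fun U => exp (β * (-wilsonAction (StrongCoupling.defRep n) U)) /
                    mgf (fun U => -wilsonAction (StrongCoupling.defRep n) U)
                      (trivialMeasure (Matrix.specialUnitaryGroup (Fin n) ℂ) d L) β)
                  q)^[m + 1] g) U ∂(wilsonMeasure (d := d) (L := L) (StrongCoupling.defRep n) β)) /
                ∫ U, g U ^ 2 ∂(wilsonMeasure (d := d) (L := L) (StrongCoupling.defRep n) β) := by
  obtain ⟨c, hc, h⟩ := wilson_flowAcc_le_sun (d := d) (n := n) hn hd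
  refine ⟨c, hc, fun L _ hL β hβ q hqm hq0 C hqC hq1 g hgm B hgb hpos m => ?_⟩
  have hρ : Continuous (StrongCoupling.defRep n) := continuous_subtype_val
  have hacc := h L hL β hβ q hqm C (fun U => (hq0 U).le) hqC
  refine le_trans ?_ (wilson_flow_autocorr_ge_pow (StrongCoupling.defRep n) hρ β hqm hq0 hq1 hgm hgb hpos m)
  refine pow_le_pow_left₀ (le_max_left _ _) (max_le_max le_rfl ?_) (m + 1)
  exact sub_le_sub_left (div_le_div_of_nonneg_right (mul_le_mul_of_nonneg_left hacc (sq_nonneg B))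
    hpos.le) 1

end SUN

end Summit.Ventures.LatticeQCDFlow.TrivializingMaps

end
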